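import Mathlib.LinearAlgebra.TensorProduct.Tower
import Mathlib.LinearAlgebra.Eigenspace.Basic
import Mathlib.LinearAlgebra.BilinearForm.Orthogonal
import Mathlib.LinearAlgebra.Dimension.Finrank
import Mathlib.GroupTheory.Index
import Mathlib.Algebra.Algebra.Rat
import Mathlib.Data.Complex.Basic
import HarnessLib

/-!
# Route `Q8SymplecticPowers`, crux K1Q — transport of the clauses (ii), ((iii)), (iv) of stub S4 along an intertwining
# linear equivalence (pure linear algebra)

Support file for crux K1Q `VeryGeneralQuaternionCommutatorsInHg` (stmt-HodgeConjecture-24190; `--supports … --as helper`; nothing here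
closes an item). Prover seat `hodge-nonav-19716-p2` (g14). This is the ALGEBRAIC half of the base-point transport glue (δ) for stub S4
`stub_transcendentalQuaternionicPartQ` (planner p3 g37, 2026-08-29); the geometric half (rational transports along a path in the base of
the `Q`-family) is `Q8SymplecticPowersTranscendentalPartTransport`. Mathlib only.

* `exists_finiteIndex_conj`, `map_spanFixed_le`, `map_spanFixed_eq` — conjugation `Γ₁ = T Γ₀ T⁻¹` by a linear equivalence `T : V₀ ≃ V₁`
  carries finite-index pairs to finite-index pairs and the finite-orbit span `N(Γ₀) = span{x | some finite-index Γ′ ≤ Γ₀ fixes x}` onto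
  `N(Γ₁)`;
* `map_eigenspace_eq`, `map_orthogonal_eq`, `baseChange_map_eq`, `baseChange_intertwines`, `baseChange_conj_apply` — bookkeeping;
* `transport_clauses` — for `T` intertwining `A₀, A₁`, scaling the forms `Q₀, Q₁` in both directions and conjugating `Γ₀` onto `Γ₁`, the
  clauses (ii) `6 ≤ dim Miv`, ((iii)) «`Miv` irreducible under every finite-index subgroup» and (iv) `N ≤ ker(A² − 1)` — written exactly
  as in the stub, with `N, Mv, Miv` given by their defining equations — pass from the `0`-side to the `1`-side.

HONEST FRAMING: linear algebra; K1Q is NOT proved; nothing here bears on HC ∕ HC_AV.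

## References
* [VoisinHodgeII2003] C. Voisin, *Hodge Theory and Complex Algebraic Geometry II*, CUP 2003, §3.1.2 (monodromy groups at path-joined
  points are conjugate by the transport).
-/

noncomputable section

set_option linter.dupNamespace false

namespace Summit.HodgeConjecture.HodgeConjecture.Theorems.Q8SymplecticPowersTransportClausesAlgebra

open scoped TensorProduct

/-! ### §1 Conjugation of finite-index pairs and of the finite-orbit span -/

section Algebra

variable {V₀ V₁ : Type*} [AddCommGroup V₀] [Module ℚ V₀] [AddCommGroup V₁] [Module ℚ V₁]

/-- Conjugation of a finite-index pair of subgroups of `GL(V₀)` by a linear equivalence `T : V₀ ≃ V₁`: if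
`Γ₀' ≤ Γ₀` has finite index and `Γ₁ ≤ GL(V₁)` satisfies `T⁻¹ Γ₁ T ⊆ Γ₀`, then
`Γ₁' := {g ∈ Γ₁ | T⁻¹ g T ∈ Γ₀'}` has finite index in `Γ₁` (here `T⁻¹ g T` is `T.trans (g.trans T.symm)`, the map
`v ↦ T⁻¹ (g (T v))`). [folklore] -/
theorem exists_finiteIndex_conj (T : V₀ ≃ₗ[ℚ] V₁) {Γ₀' Γ₀ : Subgroup (V₀ ≃ₗ[ℚ] V₀)}
    (hfi : (Γ₀'.subgroupOf Γ₀).FiniteIndex) {Γ₁ : Subgroup (V₁ ≃ₗ[ℚ] V₁)}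
    (hΓ₁ : ∀ g ∈ Γ₁, T.trans (g.trans T.symm) ∈ Γ₀) :
    ∃ Γ₁' : Subgroup (V₁ ≃ₗ[ℚ] V₁), Γ₁' ≤ Γ₁ ∧ (Γ₁'.subgroupOf Γ₁).FiniteIndex ∧
      ∀ g ∈ Γ₁', T.trans (g.trans T.symm) ∈ Γ₀' := by
  -- conjugation `g ↦ T ≫ g ≫ T⁻¹ : GL(V₁) →* GL(V₀)` (as maps, `v ↦ T⁻¹ (g (T v))`)
  let φ : (V₁ ≃ₗ[ℚ] V₁) →* (V₀ ≃ₗ[ℚ] V₀) :=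
    { toFun := fun g => T.trans (g.trans T.symm)
      map_one' := by ext v; simp [LinearEquiv.one_eq_refl]
      map_mul' := fun g₁ g₂ => by ext v; simp [LinearEquiv.mul_eq_trans] }
  have h1 : Γ₁.map φ ≤ Γ₀ := by
    rintro _ ⟨g, hg, rfl⟩
    exact hΓ₁ g hg
  have h2 : Γ₀'.relIndex (Γ₁.map φ) ≠ 0 := fun h0 =>
    hfi.index_ne_zero (Subgroup.relIndex_eq_zero_of_le_right h1 h0)
  refine ⟨Γ₀'.comap φ ⊓ Γ₁, inf_le_right, ⟨?_⟩, fun g hg => hg.1⟩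
  change (Γ₀'.comap φ ⊓ Γ₁).relIndex Γ₁ ≠ 0
  rw [Subgroup.inf_relIndex_right, Subgroup.relIndex_comap]
  exact h2

/-- If `T⁻¹ Γ₁ T ⊆ Γ₀` then `T` maps the span `N(Γ₀)` of the classes fixed by a finite-index subgroup of `Γ₀`
into `N(Γ₁)`. [folklore] -/
theorem map_spanFixed_le (T : V₀ ≃ₗ[ℚ] V₁) (Γ₀ : Subgroup (V₀ ≃ₗ[ℚ] V₀)) (Γ₁ : Subgroup (V₁ ≃ₗ[ℚ] V₁))
    (hΓ₁ : ∀ g ∈ Γ₁, T.trans (g.trans T.symm) ∈ Γ₀) :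
    Submodule.map (T : V₀ →ₗ[ℚ] V₁)
        (Submodule.span ℚ {x | ∃ Γ' : Subgroup (V₀ ≃ₗ[ℚ] V₀),
          Γ' ≤ Γ₀ ∧ (Γ'.subgroupOf Γ₀).FiniteIndex ∧ ∀ γ ∈ Γ', γ x = x}) ≤
      Submodule.span ℚ {y | ∃ Γ' : Subgroup (V₁ ≃ₗ[ℚ] V₁),
          Γ' ≤ Γ₁ ∧ (Γ'.subgroupOf Γ₁).FiniteIndex ∧ ∀ γ ∈ Γ', γ y = y} := by
  rw [Submodule.map_span]
  refine Submodule.span_mono ?_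
  rintro _ ⟨x, ⟨Γ', -, hΓ'fi, hfix⟩, rfl⟩
  obtain ⟨Γ₁', h₁le, h₁fi, h₁⟩ := exists_finiteIndex_conj T hΓ'fi hΓ₁
  refine ⟨Γ₁', h₁le, h₁fi, fun γ hγ => ?_⟩
  have h := congrArg T (hfix _ (h₁ γ hγ))
  simpa using h

/-- **`T` carries the finite-orbit span `N(Γ₀)` onto `N(Γ₁)`** when `Γ₁ = T Γ₀ T⁻¹` (both inclusions as
hypotheses, in the shapes produced by `conj_mem_ratMonodromyGroup_of_isRatTransport` and its `symm` form).
[folklore] -/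
theorem map_spanFixed_eq (T : V₀ ≃ₗ[ℚ] V₁) (Γ₀ : Subgroup (V₀ ≃ₗ[ℚ] V₀)) (Γ₁ : Subgroup (V₁ ≃ₗ[ℚ] V₁))
    (hΓ₀ : ∀ g ∈ Γ₀, T.symm.trans (g.trans T) ∈ Γ₁)
    (hΓ₁ : ∀ g ∈ Γ₁, T.trans (g.trans T.symm) ∈ Γ₀) :
    Submodule.map (T : V₀ →ₗ[ℚ] V₁)
        (Submodule.span ℚ {x | ∃ Γ' : Subgroup (V₀ ≃ₗ[ℚ] V₀),
          Γ' ≤ Γ₀ ∧ (Γ'.subgroupOf Γ₀).FiniteIndex ∧ ∀ γ ∈ Γ', γ x = x}) =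
      Submodule.span ℚ {y | ∃ Γ' : Subgroup (V₁ ≃ₗ[ℚ] V₁),
          Γ' ≤ Γ₁ ∧ (Γ'.subgroupOf Γ₁).FiniteIndex ∧ ∀ γ ∈ Γ', γ y = y} := by
  refine le_antisymm (map_spanFixed_le T Γ₀ Γ₁ hΓ₁) fun y hy => ?_
  have h := map_spanFixed_le T.symm Γ₁ Γ₀
    (fun g hg => by simpa only [LinearEquiv.symm_symm] using hΓ₀ g hg) (Submodule.mem_map_of_mem hy)
  rw [Submodule.mem_map_equiv]
  simpa using h

/-- An intertwiner carries eigenspaces onto eigenspaces: if `T ∘ f₀ = f₁ ∘ T` for a linear equivalence `T` then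
`T (ker (f₀ − μ)) = ker (f₁ − μ)`. [folklore] -/
theorem map_eigenspace_eq {K W₀ W₁ : Type*} [Field K] [AddCommGroup W₀] [Module K W₀] [AddCommGroup W₁]
    [Module K W₁] (T : W₀ ≃ₗ[K] W₁) (f₀ : Module.End K W₀) (f₁ : Module.End K W₁)
    (h : ∀ x, T (f₀ x) = f₁ (T x)) (μ : K) :
    Submodule.map (T : W₀ →ₗ[K] W₁) (f₀.eigenspace μ) = f₁.eigenspace μ := by
  ext y
  rw [Submodule.mem_map_equiv, Module.End.mem_eigenspace_iff, Module.End.mem_eigenspace_iff]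
  constructor
  · intro hy
    have h1 := h (T.symm y)
    rw [hy, LinearEquiv.apply_symm_apply, map_smul, LinearEquiv.apply_symm_apply] at h1
    exact h1.symm
  · intro hy
    apply T.injective
    rw [h, LinearEquiv.apply_symm_apply, hy, map_smul, LinearEquiv.apply_symm_apply]

/-- If `T` scales the forms in both directions (`Q₁ (T x) (T y) = d · Q₀ x y`, `Q₀ (T⁻¹ x) (T⁻¹ y) = d' · Q₁ x y`)
then `T` carries `Q₀`-orthogonal complements onto `Q₁`-orthogonal complements. [folklore] -/
theorem map_orthogonal_eq {K W₀ W₁ : Type*} [Field K] [AddCommGroup W₀] [Module K W₀] [AddCommGroup W₁]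
    [Module K W₁] (T : W₀ ≃ₗ[K] W₁) (Q₀ : LinearMap.BilinForm K W₀) (Q₁ : LinearMap.BilinForm K W₁) (d d' : K)
    (hQ : ∀ x y, Q₁ (T x) (T y) = d * Q₀ x y) (hQ' : ∀ x y, Q₀ (T.symm x) (T.symm y) = d' * Q₁ x y)
    (N₀ : Submodule K W₀) :
    Submodule.map (T : W₀ →ₗ[K] W₁) (Q₀.orthogonal N₀) =
      Q₁.orthogonal (Submodule.map (T : W₀ →ₗ[K] W₁) N₀) := by
  ext y
  rw [Submodule.mem_map_equiv, LinearMap.BilinForm.mem_orthogonal_iff, LinearMap.BilinForm.mem_orthogonal_iff]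
  constructor
  · intro hy n hn
    rw [Submodule.mem_map_equiv] at hn
    have h0 : Q₀ (T.symm n) (T.symm y) = 0 := hy _ hn
    have h1 := hQ (T.symm n) (T.symm y)
    rw [LinearEquiv.apply_symm_apply, LinearEquiv.apply_symm_apply, h0, mul_zero] at h1
    exact h1
  · intro hy n hn
    have h0 : Q₁ (T n) y = 0 :=
      hy (T n) (by rw [Submodule.mem_map_equiv, LinearEquiv.symm_apply_apply]; exact hn)
    have h1 := hQ' (T n) y
    rw [LinearEquiv.symm_apply_apply, h0, mul_zero] at h1
    exact h1

/-- Base change commutes with images under a linear equivalence: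
`(T M) ⊗ ℂ = (T ⊗ ℂ) (M ⊗ ℂ)`. [folklore] -/
theorem baseChange_map_eq (T : V₀ ≃ₗ[ℚ] V₁) (M : Submodule ℚ V₀) :
    Submodule.map (T.baseChange ℚ ℂ V₀ V₁ : ℂ ⊗[ℚ] V₀ →ₗ[ℂ] ℂ ⊗[ℚ] V₁) (M.baseChange ℂ) =
      (Submodule.map (T : V₀ →ₗ[ℚ] V₁) M).baseChange ℂ := by
  refine le_antisymm ?_ ?_
  · rw [Submodule.map_le_iff_le_comap, Submodule.baseChange_eq_span, Submodule.span_le]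
    rintro _ ⟨m, hm, rfl⟩
    rw [SetLike.mem_coe, Submodule.mem_comap]
    change (T.baseChange ℚ ℂ V₀ V₁) ((1 : ℂ) ⊗ₜ[ℚ] m) ∈ _
    rw [LinearEquiv.baseChange_tmul]
    exact Submodule.tmul_mem_baseChange_of_mem 1 (Submodule.mem_map_of_mem hm)
  · rw [Submodule.baseChange_eq_span, Submodule.span_le]
    rintro _ ⟨_, ⟨m, hm, rfl⟩, rfl⟩
    rw [SetLike.mem_coe, Submodule.mem_map_equiv]
    change (T.baseChange ℚ ℂ V₀ V₁).symm ((1 : ℂ) ⊗ₜ[ℚ] T m) ∈ _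
    rw [LinearEquiv.baseChange_symm_tmul, LinearEquiv.symm_apply_apply]
    exact Submodule.tmul_mem_baseChange_of_mem 1 hm

/-- The base change of an intertwiner intertwines the base changes. [folklore] -/
theorem baseChange_intertwines (T : V₀ ≃ₗ[ℚ] V₁) (A₀ : V₀ →ₗ[ℚ] V₀) (A₁ : V₁ →ₗ[ℚ] V₁)
    (hA : ∀ x, T (A₀ x) = A₁ (T x)) (z : ℂ ⊗[ℚ] V₀) :
    (T.baseChange ℚ ℂ V₀ V₁) (A₀.baseChange ℂ z) = A₁.baseChange ℂ ((T.baseChange ℚ ℂ V₀ V₁) z) := by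
  induction z using TensorProduct.induction_on with
  | zero => simp only [map_zero]
  | add a b ha hb => simp only [map_add, ha, hb]
  | tmul c v => simp only [LinearMap.baseChange_tmul, LinearEquiv.baseChange_tmul, hA]

/-- Conjugation of a base-changed group element: for `g := T⁻¹ ≫ γ ≫ T` (`w ↦ T (γ (T⁻¹ w))`),
`(g ⊗ ℂ) (T ⊗ ℂ) z = (T ⊗ ℂ) ((γ ⊗ ℂ) z)`. [folklore] -/
theorem baseChange_conj_apply (T : V₀ ≃ₗ[ℚ] V₁) (γ : V₀ ≃ₗ[ℚ] V₀) (z : ℂ ⊗[ℚ] V₀) :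
    ((T.symm.trans (γ.trans T)).toLinearMap.baseChange ℂ) ((T.baseChange ℚ ℂ V₀ V₁) z) =
      (T.baseChange ℚ ℂ V₀ V₁) ((γ.toLinearMap.baseChange ℂ) z) := by
  induction z using TensorProduct.induction_on with
  | zero => simp only [map_zero]
  | add a b ha hb => simp only [map_add, ha, hb]
  | tmul c v =>
    simp only [LinearMap.baseChange_tmul, LinearEquiv.baseChange_tmul, LinearEquiv.coe_coe,
      LinearEquiv.trans_apply, LinearEquiv.symm_apply_apply]

/-- **Transport of the clauses (ii), ((iii)), (iv) of `stub_transcendentalQuaternionicPartQ` along an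
intertwining linear equivalence** (abstract form). Data: `T : V₀ ≃ V₁`; endomorphisms `A₀, A₁` with
`T A₀ = A₁ T`; forms `Q₀, Q₁` scaled by `T` in both directions; groups `Γ₀, Γ₁` with `Γ₁ = T Γ₀ T⁻¹`; and the
derived objects `N, Mv, Miv` of the stub at both ends (as defining equations). Then `T` carries `N₀, Mv₀, Miv₀`
onto `N₁, Mv₁, Miv₁`, so `finrank Miv`, the strong irreducibility of `Miv` under every finite-index subgroup, and
`N ≤ ker(A² − 1)` pass from the `0`-side to the `1`-side. [folklore] -/
theorem transport_clauses (T : V₀ ≃ₗ[ℚ] V₁) (A₀ : V₀ →ₗ[ℚ] V₀) (A₁ : V₁ →ₗ[ℚ] V₁)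
    (hA : ∀ x, T (A₀ x) = A₁ (T x))
    (Q₀ : LinearMap.BilinForm ℚ V₀) (Q₁ : LinearMap.BilinForm ℚ V₁) (d d' : ℚ)
    (hQ : ∀ x y, Q₁ (T x) (T y) = d * Q₀ x y) (hQ' : ∀ x y, Q₀ (T.symm x) (T.symm y) = d' * Q₁ x y)
    (Γ₀ : Subgroup (V₀ ≃ₗ[ℚ] V₀)) (Γ₁ : Subgroup (V₁ ≃ₗ[ℚ] V₁))
    (hΓ₀ : ∀ g ∈ Γ₀, T.symm.trans (g.trans T) ∈ Γ₁) (hΓ₁ : ∀ g ∈ Γ₁, T.trans (g.trans T.symm) ∈ Γ₀)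
    (N₀ Mv₀ : Submodule ℚ V₀) (Miv₀ : Submodule ℂ (ℂ ⊗[ℚ] V₀))
    (N₁ Mv₁ : Submodule ℚ V₁) (Miv₁ : Submodule ℂ (ℂ ⊗[ℚ] V₁))
    (hN₀ : N₀ = Submodule.span ℚ {x | ∃ Γ' : Subgroup (V₀ ≃ₗ[ℚ] V₀),
      Γ' ≤ Γ₀ ∧ (Γ'.subgroupOf Γ₀).FiniteIndex ∧ ∀ γ ∈ Γ', γ x = x})
    (hMv₀ : Mv₀ = Module.End.eigenspace (A₀ ^ 2) (-1) ⊓ Q₀.orthogonal N₀)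
    (hMiv₀ : Miv₀ = Mv₀.baseChange ℂ ⊓ Module.End.eigenspace (A₀.baseChange ℂ) Complex.I)
    (hN₁ : N₁ = Submodule.span ℚ {x | ∃ Γ' : Subgroup (V₁ ≃ₗ[ℚ] V₁),
      Γ' ≤ Γ₁ ∧ (Γ'.subgroupOf Γ₁).FiniteIndex ∧ ∀ γ ∈ Γ', γ x = x})
    (hMv₁ : Mv₁ = Module.End.eigenspace (A₁ ^ 2) (-1) ⊓ Q₁.orthogonal N₁)
    (hMiv₁ : Miv₁ = Mv₁.baseChange ℂ ⊓ Module.End.eigenspace (A₁.baseChange ℂ) Complex.I) :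
    (6 ≤ Module.finrank ℂ Miv₀ ∧
      (∀ Γ' : Subgroup (V₀ ≃ₗ[ℚ] V₀), Γ' ≤ Γ₀ → (Γ'.subgroupOf Γ₀).FiniteIndex →
        ∀ F : Submodule ℂ (ℂ ⊗[ℚ] V₀), F ≤ Miv₀ →
          (∀ γ ∈ Γ', ∀ x ∈ F, (γ.toLinearMap.baseChange ℂ) x ∈ F) → F = ⊥ ∨ F = Miv₀) ∧
      N₀ ≤ Module.End.eigenspace (A₀ ^ 2) 1) →
    (6 ≤ Module.finrank ℂ Miv₁ ∧
      (∀ Γ' : Subgroup (V₁ ≃ₗ[ℚ] V₁), Γ' ≤ Γ₁ → (Γ'.subgroupOf Γ₁).FiniteIndex →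
        ∀ F : Submodule ℂ (ℂ ⊗[ℚ] V₁), F ≤ Miv₁ →
          (∀ γ ∈ Γ', ∀ x ∈ F, (γ.toLinearMap.baseChange ℂ) x ∈ F) → F = ⊥ ∨ F = Miv₁) ∧
      N₁ ≤ Module.End.eigenspace (A₁ ^ 2) 1) := by
  rintro ⟨hii, hiii, hiv⟩
  set E : ℂ ⊗[ℚ] V₀ ≃ₗ[ℂ] ℂ ⊗[ℚ] V₁ := T.baseChange ℚ ℂ V₀ V₁ with hE
  -- `T` intertwines `A₀²`, `A₁²`; it carries `N₀ ↦ N₁`, `Mv₀ ↦ Mv₁`, and `E = T ⊗ ℂ` carries `Miv₀ ↦ Miv₁`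
  have hA2 : ∀ x, T ((A₀ ^ 2) x) = (A₁ ^ 2) (T x) := fun x => by
    simp only [pow_two, Module.End.mul_apply, hA]
  have hN : Submodule.map (T : V₀ →ₗ[ℚ] V₁) N₀ = N₁ := by
    rw [hN₀, hN₁]
    exact map_spanFixed_eq T Γ₀ Γ₁ hΓ₀ hΓ₁
  have hMv : Submodule.map (T : V₀ →ₗ[ℚ] V₁) Mv₀ = Mv₁ := by
    rw [hMv₀, hMv₁, Submodule.map_inf _ T.injective, map_eigenspace_eq T _ _ hA2,
      map_orthogonal_eq T Q₀ Q₁ d d' hQ hQ', hN]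
  have hMiv : Submodule.map (E : ℂ ⊗[ℚ] V₀ →ₗ[ℂ] ℂ ⊗[ℚ] V₁) Miv₀ = Miv₁ := by
    rw [hMiv₀, hMiv₁, hE, Submodule.map_inf _ (T.baseChange ℚ ℂ V₀ V₁).injective, baseChange_map_eq,
      map_eigenspace_eq (T.baseChange ℚ ℂ V₀ V₁) _ _ (baseChange_intertwines T A₀ A₁ hA), hMv]
  refine ⟨?_, ?_, ?_⟩
  · -- (ii)
    rw [← hMiv, LinearEquiv.finrank_map_eq]
    exact hii
  · -- ((iii))
    intro Γ' hΓ'le hΓ'fi F hF hFst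
    -- the finite-index subgroup `Γ₀' := T⁻¹ Γ' T ∩ Γ₀` of `Γ₀`
    obtain ⟨Γ₀', h₀le, h₀fi, h₀⟩ := exists_finiteIndex_conj T.symm hΓ'fi (Γ₁ := Γ₀)
      (fun g hg => by simpa only [LinearEquiv.symm_symm] using hΓ₀ g hg)
    -- the pulled-back subspace `F₀ := E⁻¹ F`
    set F₀ : Submodule ℂ (ℂ ⊗[ℚ] V₀) :=
      Submodule.map (E.symm : ℂ ⊗[ℚ] V₁ →ₗ[ℂ] ℂ ⊗[ℚ] V₀) F with hF₀
    have hmemF₀ : ∀ z, z ∈ F₀ ↔ E z ∈ F := fun z => by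
      rw [hF₀, Submodule.mem_map_equiv, LinearEquiv.symm_symm]
    have hF₀le : F₀ ≤ Miv₀ := by
      intro z hz
      have h1 := hF ((hmemF₀ z).1 hz)
      rw [← hMiv, Submodule.mem_map_equiv, LinearEquiv.symm_apply_apply] at h1
      exact h1
    have hF₀st : ∀ γ ∈ Γ₀', ∀ z ∈ F₀, (γ.toLinearMap.baseChange ℂ) z ∈ F₀ := by
      intro γ hγ z hz
      rw [hmemF₀] at hz ⊢
      have hg : T.symm.trans (γ.trans T) ∈ Γ' := by
        simpa only [LinearEquiv.symm_symm] using h₀ γ hγ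
      have h1 := hFst _ hg _ hz
      rwa [hE, baseChange_conj_apply] at h1
    rcases hiii Γ₀' h₀le h₀fi F₀ hF₀le hF₀st with h0 | h0
    · left
      rw [eq_bot_iff]
      intro y hy
      have h1 : E.symm y ∈ F₀ := (hmemF₀ _).2 (by rwa [LinearEquiv.apply_symm_apply])
      rw [h0, Submodule.mem_bot, LinearEquiv.map_eq_zero_iff] at h1
      rw [h1]
      exact Submodule.zero_mem _
    · right
      rw [← hMiv, ← h0]
      ext y
      rw [Submodule.mem_map_equiv, hmemF₀, LinearEquiv.apply_symm_apply]
  · -- (iv)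
    rw [← hN, ← map_eigenspace_eq T _ _ hA2 1]
    exact Submodule.map_mono hiv

end Algebra



end Summit.HodgeConjecture.HodgeConjecture.Theorems.Q8SymplecticPowersTransportClausesAlgebra

end
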